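import Summits.QuantumFields.BalabanUV.Beta.GAN24.HkStaircaseOneStep
import Summits.QuantumFields.BalabanUV.Beta.GAN24.AveragedPropagatorDecayCubic

/-!
# `BalabanUV.Beta.GAN24.SoftColumnKernelDecay` — binder row G-an2-4 ∕ (CONV-C), route R7: the `H_k` laws of `HkKingOneStep(Sup)` in road P2's
# `RowDecay` currency (every torus, every `a`), and — with road P2's kernel laws for the averaged propagator — THE SOFT COLUMN MAP `colOp = 𝒢_aQ*`
# (fine × unit) IN (CONV-C)'s LITERAL TWO-CLAUSE KERNEL SHAPE against King's parent, at `a = 1` on cubic unit tori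

NOT IN PRINT; OUR PROOF ATTEMPT (prover part P3 of row G-an2-4, fibre∕strip («Woodbury») lineage, gen 27; CRUX TEAM (2), ruling «YM
REDIRECT TOWARDS THE SUMMIT», 2026-08-21).  HONEST DEPENDENCY (cell records, verbatim): «continuum YM on T⁴ ⇐ BetaPertH ∧ nine spine
estimates (0/9 proved); BetaPertH ⇐ (D1) ∧ (D4) ∧ CAP+tail; G-an2-4 gates asym, D1 and NE2/3/4.»  HONEST FRAMING (cell contract, verbatim):
«discharging `BetaPertH` makes Bałaban's UV stability UNCONDITIONAL — a real constructive-QFT result; it is NOT the continuum limit and NOT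
the Clay problem.»  ABSOLUTE RULE: nothing printed is a hypothesis; no `def … : Prop`, no sorry; [folklore] assembly over TREE objects BY NAME.

## Content

 * §1 (every torus `M`, every level): **`rowDecay_HkOp`** — b05's `norm_HkOp_le` as `RowDecay M (blockOf n ∘ fst) fst (HkOp n M) ((d+1)·MG163·periodConst) dec`;
   **`rowDecay_Hk_sub_stairV`** — THIS GEN's `HkKingOneStepSup.norm_HkOp_par_sub_le` as
   `RowDecay M (blockOf (RN) ∘ fst) fst (HkOp (R·N) M − stairV·HkOp N M) ((d+1)·KH1 d∕N) dec` (the one-step clause of the constituent `H`, per-block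
   row sums, every `a`-free object here).
 * §2 (`a = 1`, cubic unit tori `T = fun _ => N₀`, every `N, R, N₀ ≥ 1`): with road P2's `covOp_kernel_decay_cubic` ∕ `norm_covOp_succ_sub_apply_le_cubic`
   (the unit covariance `c_n = Q𝒢Q*` in kernel currency, letters = leaf-06's `vectorRowDecay_one_cubic`) and leaf-04's exact split `colOp′ − J·colOp =
   H′·(c′ − c) + (H′ − J·H)·c` (`SoftColumnTwoLevel.colOp_succ_sub_eq_Hk`), the resummation `BlockFieldDecay.fieldDecay_mulVec` gives
   **`colOp_kernel_decay_cubic`**: `‖colOp n T 1 (X, q)‖ ≤ K·e^{−δ·|ȳ(X) − ȳ(q)|_T}` and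
   **`norm_colOp_sub_stairV_apply_le_cubic`**: `‖(colOp (R·N) T 1 − stairV·colOp N T 1)(X′, q)‖ ≤ K·(ρ·ℓ + 1∕N)·e^{−δ·|ȳ(X′) − ȳ(q)|_T}`,
   `ρ = (R−1)∕(RN)`, `ℓ = 2 + log(RN) + log N` — the soft column map `𝒢Q*` (the legs `a·n^d·𝒢Q_kᴴe_q` of the lineage's chains, road P2's `MsoftV∕a`)
   in (CONV-C)'s literal two-clause kernel shape (fine bond × unit bond, King's parent), `N₀`-uniform; along `n_k = L^k` the amplitude is
   `K′·(k+1)·L^{−k}` — summable (the log is road P2's, inherited from `c′ − c`; the `H` factor carries none).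

HONEST SCOPE.  [folklore] bookkeeping BY NAME (this gen's A1∕A2∕C + road P2 Parts 8–10 + leaf-04 + leaf-06's letters); `U = 1`; §2 at `a = 1` CUBIC only
(road P2's scope); constants existential in `d` (road P2's style); NOT (CONV-C) as a whole, NEVER «G-an2-4 closed», NOT NE2, NOT D1, NOT BetaPertH,
NOT continuum, NOT Clay.  Locators (text only): [Balaban1984PropagatorsI] (1.63) p. 28, (1.71) p. 29, (1.103) p. 35; [King1986] p. 664.
Provenance: prover-b2b-balaban-gan24-p3-g27-0 (unit `b2b-balaban-gan24-p3`, gen 27), 2026-08-21.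
-/

noncomputable section

open scoped BigOperators ComplexConjugate Matrix
open Finset

namespace Summit.QuantumFields.BalabanUV.Beta.GAN24.SoftColumnKernelDecay

open Literature.MathematicalPhysics.QuantumFieldTheory.Balaban1983to89
open Literature.MathematicalPhysics.QuantumFieldTheory.Balaban1983to89.B5Prop11Plancherel (Tor fine)
open Literature.MathematicalPhysics.QuantumFieldTheory.Balaban1983to89.B4TorusKernel (periodConst)
open Literature.MathematicalPhysics.QuantumFieldTheory.Balaban1983to89.B4TorusKernel.MultiPeriod (torusSupNorm)
open Literature.MathematicalPhysics.QuantumFieldTheory.Balaban1983to89.B4Sect5Proof (latticeConst latticeConst_nonneg)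
open Literature.MathematicalPhysics.QuantumFieldTheory.Balaban1983to89.B5Blocks16 (blockOf)
open Literature.MathematicalPhysics.QuantumFieldTheory.Balaban1983to89.B5Kernel166Decay (periodConst_pos)
open Literature.MathematicalPhysics.QuantumFieldTheory.Balaban1983to89.B6LowerBound2153Torus (toT rep toT_rep)
open Literature.MathematicalPhysics.QuantumFieldTheory.Balaban1983to89.B5Hk163Strip (kappa163 kappa163_pos)
open Literature.MathematicalPhysics.QuantumFieldTheory.Balaban1983to89.B5Hk163Decay (MG163 MG163_nonneg)
open Literature.MathematicalPhysics.QuantumFieldTheory.Balaban1983to89.B5Hk163Torus (HkOp)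
open Literature.MathematicalPhysics.QuantumFieldTheory.Balaban1983to89.B5Hk163Form166 (HkOp_eq_Hk)
open Literature.MathematicalPhysics.QuantumFieldTheory.Balaban1983to89.Beta.FluctuationProjection (Hk digitOf bpt_blockOf_digitOf)
open Summit.QuantumFields.BalabanUV.T4Continuum.BalabanAveragedTowerModes (par)
open Summit.QuantumFields.BalabanUV.T4Continuum.BlockPairingGeometry (parT)
open Summit.QuantumFields.BalabanUV.Beta.GAN24.StaircaseAveragingDefect (stairV stairV_mulVec)
open Summit.QuantumFields.BalabanUV.Beta.GAN24.AveragedPropagatorTwoLevel (covOp)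
open Summit.QuantumFields.BalabanUV.Beta.GAN24.BlockFieldDecay (RowDecay FieldDecay fieldDecay_mulVec)
open Summit.QuantumFields.BalabanUV.Beta.GAN24.AveragedPropagatorDecayCubic (covOp_kernel_decay_cubic norm_covOp_succ_sub_apply_le_cubic)
open Summit.QuantumFields.BalabanUV.Beta.GAN24.SoftColumnTwoLevel (colOp colOp_eq_Hk_mul_covOp colOp_succ_sub_eq_Hk)
open Summit.QuantumFields.BalabanUV.Beta.GAN24.HkKingOneStep (dec dec_pos KH1 KH1_nonneg norm_HkOp_bpt_le)
open Summit.QuantumFields.BalabanUV.Beta.GAN24.HkKingOneStepSup (norm_HkOp_par_sub_le)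
open Summit.QuantumFields.BalabanUV.Beta.GAN24.HkStaircaseOneStep (stairV_mul_apply)

variable {d : ℕ}

/-! ## §1 The `H_k` laws as per-block row decay (every torus) -/

section Rows

variable (M : Fin (d + 1) → ℕ) [hM : ∀ μ, NeZero (M μ)]

/-- **b05's kernel decay of `H_k` as `RowDecay`**: for every fine bond `X` and unit site `y′`,
`Σ_λ ‖H_n(X, (y′, λ))‖ ≤ (d+1)·MG163(d+1)·periodConst·e^{−dec·|ȳ(X) − ȳ(y′)|_T}`. [folklore] -/
theorem rowDecay_HkOp (n : ℕ) [NeZero n] :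
    RowDecay M (fun X : Tor (fine n M) × Fin (d + 1) => blockOf n M X.1) (fun i : Tor M × Fin (d + 1) => i.1) (HkOp n M)
      ((d + 1) * (MG163 (d + 1) * periodConst (kappa163 (d + 1)) d)) (dec d) := by
  intro X y'
  obtain ⟨x, μ⟩ := X
  have hx : x = B5Block118.bpt n M (toT M (rep M (blockOf n M x))) (digitOf n M x) := by rw [toT_rep, bpt_blockOf_digitOf]
  have hterm : ∀ lam : Fin (d + 1), ‖HkOp n M (x, μ) (y', lam)‖
      ≤ MG163 (d + 1) * periodConst (kappa163 (d + 1)) d * Real.exp (-(dec d * torusSupNorm M (rep M (blockOf n M x) - rep M y'))) := by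
    intro lam
    have h := norm_HkOp_bpt_le n M μ lam (digitOf n M x) (rep M (blockOf n M x)) (rep M y')
    rw [← hx, toT_rep] at h
    exact h
  rw [Fintype.sum_prod_type]
  dsimp only
  calc ∑ y : Tor M, ∑ lam : Fin (d + 1), (if y = y' then ‖HkOp n M (x, μ) (y, lam)‖ else 0)
      = ∑ lam : Fin (d + 1), ‖HkOp n M (x, μ) (y', lam)‖ := by
        rw [Finset.sum_comm]
        exact Finset.sum_congr rfl fun lam _ => by rw [Finset.sum_ite_eq' Finset.univ y', if_pos (Finset.mem_univ _)]
    _ ≤ ∑ _lam : Fin (d + 1), MG163 (d + 1) * periodConst (kappa163 (d + 1)) d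
          * Real.exp (-(dec d * torusSupNorm M (rep M (blockOf n M x) - rep M y'))) := Finset.sum_le_sum fun lam _ => hterm lam
    _ = (d + 1) * (MG163 (d + 1) * periodConst (kappa163 (d + 1)) d)
          * Real.exp (-(dec d * torusSupNorm M (rep M (blockOf n M x) - rep M y'))) := by
        simp only [Finset.sum_const, Finset.card_univ, Fintype.card_fin, nsmul_eq_mul]; push_cast; ring

/-- **THIS GEN's one-step law of `H_k` against King's parent as `RowDecay`**: for every fine bond `X′` of level `RN` and unit site `y′`,
`Σ_λ ‖(H_{RN} − stairV·H_N)(X′, (y′, λ))‖ ≤ (d+1)·KH1(d)∕N·e^{−dec·|ȳ(X′) − ȳ(y′)|_T}`. [folklore] -/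
theorem rowDecay_HkOp_sub_stairV (N R : ℕ) [NeZero N] [NeZero R] :
    RowDecay M (fun X : Tor (fine (R * N) M) × Fin (d + 1) => blockOf (R * N) M X.1) (fun i : Tor M × Fin (d + 1) => i.1)
      (HkOp (R * N) M - stairV N R M * HkOp N M) ((d + 1) * (KH1 d / N)) (dec d) := by
  intro X y'
  have hterm : ∀ lam : Fin (d + 1), ‖(HkOp (R * N) M - stairV N R M * HkOp N M) X (y', lam)‖
      ≤ KH1 d / N * Real.exp (-(dec d * torusSupNorm M (rep M (blockOf (R * N) M X.1) - rep M y'))) := by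
    intro lam
    have h := norm_HkOp_par_sub_le (N := N) (R := R) M X (rep M y') lam
    rw [toT_rep] at h
    rw [Matrix.sub_apply, stairV_mul_apply]
    exact h
  rw [Fintype.sum_prod_type]
  dsimp only
  calc ∑ y : Tor M, ∑ lam : Fin (d + 1), (if y = y' then ‖(HkOp (R * N) M - stairV N R M * HkOp N M) X (y, lam)‖ else 0)
      = ∑ lam : Fin (d + 1), ‖(HkOp (R * N) M - stairV N R M * HkOp N M) X (y', lam)‖ := by
        rw [Finset.sum_comm]
        exact Finset.sum_congr rfl fun lam _ => by rw [Finset.sum_ite_eq' Finset.univ y', if_pos (Finset.mem_univ _)]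
    _ ≤ ∑ _lam : Fin (d + 1), KH1 d / N * Real.exp (-(dec d * torusSupNorm M (rep M (blockOf (R * N) M X.1) - rep M y'))) :=
        Finset.sum_le_sum fun lam _ => hterm lam
    _ = (d + 1) * (KH1 d / N) * Real.exp (-(dec d * torusSupNorm M (rep M (blockOf (R * N) M X.1) - rep M y'))) := by
        simp only [Finset.sum_const, Finset.card_univ, Fintype.card_fin, nsmul_eq_mul]; push_cast; ring

end Rows

/-! ## §2 The soft column map `colOp = 𝒢Q*` in (CONV-C)'s two-clause kernel shape, `a = 1`, cubic unit tori -/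

section Cubic

/-- the column `q` of a unit-lattice operator, as a field on unit bonds. OURS (bookkeeping). [folklore] -/
def col {N₀ : ℕ} (c : Matrix (Tor (fun _ : Fin (d + 1) => N₀) × Fin (d + 1)) (Tor (fun _ : Fin (d + 1) => N₀) × Fin (d + 1)) ℂ)
    (q : Tor (fun _ : Fin (d + 1) => N₀) × Fin (d + 1)) : Tor (fun _ : Fin (d + 1) => N₀) × Fin (d + 1) → ℂ :=
  fun j => c j q

/-- `(A·c)(X, q) = (A *ᵥ col c q)(X)`. [folklore] -/
theorem mul_apply_eq_mulVec_col {ι : Type*} {N₀ : ℕ} [NeZero N₀] (A : Matrix ι (Tor (fun _ : Fin (d + 1) => N₀) × Fin (d + 1)) ℂ)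
    (c : Matrix (Tor (fun _ : Fin (d + 1) => N₀) × Fin (d + 1)) (Tor (fun _ : Fin (d + 1) => N₀) × Fin (d + 1)) ℂ)
    (X : ι) (q : Tor (fun _ : Fin (d + 1) => N₀) × Fin (d + 1)) : (A * c) X q = (A *ᵥ col c q) X := by
  rfl

/-- **THE SOFT COLUMN MAP IN (CONV-C)'s TWO-CLAUSE KERNEL SHAPE (fine bond × unit bond, King's parent), `a = 1`, CUBIC**: there are `K, δ > 0`
(functions of `d`) such that for every `N, R, N₀ ≥ 1`, every fine bond `X` (resp. `X′` of level `RN`) and unit bond `q`,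
 (i) `‖colOp n T 1 (X, q)‖ ≤ K·e^{−δ·|ȳ(X) − ȳ(q)|_T}` (every level `n`), and
 (ii) `‖(colOp (R·N) T 1 − stairV·colOp N T 1)(X′, q)‖ ≤ K·((R−1)∕(RN)·(2 + log(RN) + log N) + 1∕N)·e^{−δ·|ȳ(X′) − ȳ(q)|_T}`
(`T = fun _ => N₀`; `ȳ(·)` = the lattice representative of the block ∕ site).  MECHANISM: (1.103) `colOp = H_k·c` and leaf-04's split
`colOp′ − J colOp = H′·(c′ − c) + (H′ − J·H)·c`; §1's row decays × road P2's kernel laws for `c`, `c′ − c` through `BlockFieldDecay.fieldDecay_mulVec`.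
[cite: Balaban1984PropagatorsI, (1.103) p.35; King1986, p.664] [folklore] -/
theorem colOp_two_clauses_cubic (d : ℕ) :
    ∃ K δ : ℝ, 0 < K ∧ 0 < δ ∧
      (∀ (n N₀ : ℕ) [NeZero n] [NeZero N₀] (X : Tor (fine n (fun _ : Fin (d + 1) => N₀)) × Fin (d + 1))
          (q : Tor (fun _ : Fin (d + 1) => N₀) × Fin (d + 1)),
        ‖colOp n (fun _ : Fin (d + 1) => N₀) 1 X q‖
          ≤ K * Real.exp (-(δ * torusSupNorm (fun _ : Fin (d + 1) => N₀)
              (rep (fun _ : Fin (d + 1) => N₀) (blockOf n (fun _ : Fin (d + 1) => N₀) X.1) - rep (fun _ : Fin (d + 1) => N₀) q.1)))) ∧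
      (∀ (N R N₀ : ℕ) [NeZero N] [NeZero R] [NeZero N₀] (X' : Tor (fine (R * N) (fun _ : Fin (d + 1) => N₀)) × Fin (d + 1))
          (q : Tor (fun _ : Fin (d + 1) => N₀) × Fin (d + 1)),
        ‖(colOp (R * N) (fun _ : Fin (d + 1) => N₀) 1 - stairV N R (fun _ : Fin (d + 1) => N₀) * colOp N (fun _ : Fin (d + 1) => N₀) 1) X' q‖
          ≤ K * ((((R : ℝ) - 1) / ((R : ℝ) * N)) * (2 + Real.log ((R * N : ℕ) : ℝ) + Real.log (N : ℝ)) + 1 / N)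
              * Real.exp (-(δ * torusSupNorm (fun _ : Fin (d + 1) => N₀)
                  (rep (fun _ : Fin (d + 1) => N₀) (blockOf (R * N) (fun _ : Fin (d + 1) => N₀) X'.1)
                    - rep (fun _ : Fin (d + 1) => N₀) q.1)))) := by
  obtain ⟨Kc, δc, hKc, hδc, hc⟩ := covOp_kernel_decay_cubic d
  obtain ⟨Kd, δd, hKd, hδd, hdiff⟩ := norm_covOp_succ_sub_apply_le_cubic d
  -- common rate and constants
  set δm : ℝ := min (dec d) (min δc δd) with hδm
  have hδm0 : 0 < δm := lt_min (dec_pos d) (lt_min hδc hδd)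
  have hδm1 : δm ≤ dec d := min_le_left _ _
  have hδm2 : δm ≤ δc := (min_le_right _ _).trans (min_le_left _ _)
  have hδm3 : δm ≤ δd := (min_le_right _ _).trans (min_le_right _ _)
  set CH : ℝ := (d + 1) * (MG163 (d + 1) * periodConst (kappa163 (d + 1)) d) with hCH
  have hCH0 : 0 ≤ CH := by
    have := MG163_nonneg (d + 1); have := (periodConst_pos (kappa163_pos (d + 1)) d).le
    rw [hCH]; positivity
  have hCK0 : 0 ≤ ((d : ℝ) + 1) * KH1 d := by have := KH1_nonneg d; positivity
  set Λ : ℝ := latticeConst (d + 1) (δm / 2) with hΛ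
  have hΛ0 : 0 ≤ Λ := latticeConst_nonneg _ (half_pos hδm0).le
  refine ⟨(CH * Kc + CH * Kd + ((d : ℝ) + 1) * KH1 d * Kc) * Λ + 1, δm / 2, by positivity, half_pos hδm0, ?_, ?_⟩
  · -- (i) the uniform decay: `colOp = H·c`, rows of `H` × the column of `c`
    intro n N₀ _ _ X q
    have hn : 1 ≤ n := Nat.one_le_iff_ne_zero.mpr (NeZero.ne n)
    have hrow := (rowDecay_HkOp (fun _ : Fin (d + 1) => N₀) n).mono le_rfl hCH0 hδm1
    have hcol : FieldDecay (fun _ : Fin (d + 1) => N₀) (fun i : Tor (fun _ : Fin (d + 1) => N₀) × Fin (d + 1) => i.1)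
        (col (covOp n (fun _ : Fin (d + 1) => N₀) 1) q) Kc δm q.1 := by
      intro j
      refine (hc n N₀ j q).trans ?_
      have ht := B4TorusKernel.MultiPeriod.torusSupNorm_nonneg (fun i => Nat.one_le_iff_ne_zero.mpr (NeZero.ne ((fun _ : Fin (d + 1) => N₀) i)))
        (rep (fun _ : Fin (d + 1) => N₀) j.1 - rep (fun _ : Fin (d + 1) => N₀) q.1)
      exact mul_le_mul_of_nonneg_left (Real.exp_le_exp.mpr (by nlinarith)) hKc.le
    have hF := fieldDecay_mulVec hrow hδm0 hcol hKc.le X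
    have e : colOp n (fun _ : Fin (d + 1) => N₀) 1 X q = (HkOp n (fun _ : Fin (d + 1) => N₀) *ᵥ col (covOp n (fun _ : Fin (d + 1) => N₀) 1) q) X := by
      rw [colOp_eq_Hk_mul_covOp n (fun _ : Fin (d + 1) => N₀) 1 hn one_pos, ← HkOp_eq_Hk n hn (fun _ : Fin (d + 1) => N₀) 1 one_pos, mul_apply_eq_mulVec_col]
    rw [e]
    refine hF.trans (mul_le_mul_of_nonneg_right ?_ (Real.exp_pos _).le)
    have : CH * Kc * Λ ≤ (CH * Kc + CH * Kd + ((d : ℝ) + 1) * KH1 d * Kc) * Λ := by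
      apply mul_le_mul_of_nonneg_right _ hΛ0; nlinarith [mul_nonneg hCH0 hKd.le, mul_nonneg hCK0 hKc.le]
    linarith
  · -- (ii) the one-step law: leaf-04's split, two resummations
    intro N R N₀ _ _ _ X' q
    have hN : 1 ≤ N := Nat.one_le_iff_ne_zero.mpr (NeZero.ne N)
    have hRN : 1 ≤ R * N := Nat.one_le_iff_ne_zero.mpr (NeZero.ne (R * N))
    have hN0 : (0 : ℝ) < N := by exact_mod_cast hN
    have hρ : 0 ≤ ((R : ℝ) - 1) / ((R : ℝ) * N) := by
      have hR1 : (1 : ℝ) ≤ R := by exact_mod_cast Nat.one_le_iff_ne_zero.mpr (NeZero.ne R)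
      exact div_nonneg (by linarith) (by positivity)
    have hℓ : 0 ≤ 2 + Real.log ((R * N : ℕ) : ℝ) + Real.log (N : ℝ) := by
      have h1 : 0 ≤ Real.log ((R * N : ℕ) : ℝ) := Real.log_nonneg (by exact_mod_cast hRN)
      have h2 : 0 ≤ Real.log (N : ℝ) := Real.log_nonneg (by exact_mod_cast hN)
      linarith
    set ε : ℝ := ((R : ℝ) - 1) / ((R : ℝ) * N) * (2 + Real.log ((R * N : ℕ) : ℝ) + Real.log (N : ℝ)) with hε
    have hε0 : 0 ≤ ε := mul_nonneg hρ hℓ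
    -- the two row decays and the two column fields, at the common rate
    have hrow1 := (rowDecay_HkOp (fun _ : Fin (d + 1) => N₀) (R * N)).mono le_rfl hCH0 hδm1
    have hrow2 := (rowDecay_HkOp_sub_stairV (fun _ : Fin (d + 1) => N₀) N R).mono le_rfl
      (mul_nonneg (by positivity) (div_nonneg (KH1_nonneg d) (Nat.cast_nonneg _))) hδm1
    have hcol1 : FieldDecay (fun _ : Fin (d + 1) => N₀) (fun i : Tor (fun _ : Fin (d + 1) => N₀) × Fin (d + 1) => i.1)
        (col (covOp (R * N) (fun _ : Fin (d + 1) => N₀) 1 - covOp N (fun _ : Fin (d + 1) => N₀) 1) q) (Kd * ε) δm q.1 := by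
      intro j
      have h := hdiff N R N₀ j q
      refine h.trans ?_
      have ht := B4TorusKernel.MultiPeriod.torusSupNorm_nonneg (fun i => Nat.one_le_iff_ne_zero.mpr (NeZero.ne ((fun _ : Fin (d + 1) => N₀) i)))
        (rep (fun _ : Fin (d + 1) => N₀) j.1 - rep (fun _ : Fin (d + 1) => N₀) q.1)
      rw [hε, show Kd * (((R : ℝ) - 1) / ((R : ℝ) * N)) * (2 + Real.log ((R * N : ℕ) : ℝ) + Real.log (N : ℝ))
          = Kd * (((R : ℝ) - 1) / ((R : ℝ) * N) * (2 + Real.log ((R * N : ℕ) : ℝ) + Real.log (N : ℝ))) by ring]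
      exact mul_le_mul_of_nonneg_left (Real.exp_le_exp.mpr (by nlinarith)) (mul_nonneg hKd.le hε0)
    have hcol2 : FieldDecay (fun _ : Fin (d + 1) => N₀) (fun i : Tor (fun _ : Fin (d + 1) => N₀) × Fin (d + 1) => i.1)
        (col (covOp N (fun _ : Fin (d + 1) => N₀) 1) q) Kc δm q.1 := by
      intro j
      refine (hc N N₀ j q).trans ?_
      have ht := B4TorusKernel.MultiPeriod.torusSupNorm_nonneg (fun i => Nat.one_le_iff_ne_zero.mpr (NeZero.ne ((fun _ : Fin (d + 1) => N₀) i)))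
        (rep (fun _ : Fin (d + 1) => N₀) j.1 - rep (fun _ : Fin (d + 1) => N₀) q.1)
      exact mul_le_mul_of_nonneg_left (Real.exp_le_exp.mpr (by nlinarith)) hKc.le
    have hF1 := fieldDecay_mulVec hrow1 hδm0 hcol1 (mul_nonneg hKd.le hε0) X'
    have hF2 := fieldDecay_mulVec hrow2 hδm0 hcol2 hKc.le X'
    -- the split
    have e : (colOp (R * N) (fun _ : Fin (d + 1) => N₀) 1 - stairV N R (fun _ : Fin (d + 1) => N₀) * colOp N (fun _ : Fin (d + 1) => N₀) 1) X' q
        = (HkOp (R * N) (fun _ : Fin (d + 1) => N₀) *ᵥ col (covOp (R * N) (fun _ : Fin (d + 1) => N₀) 1 - covOp N (fun _ : Fin (d + 1) => N₀) 1) q) X'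
          + ((HkOp (R * N) (fun _ : Fin (d + 1) => N₀) - stairV N R (fun _ : Fin (d + 1) => N₀) * HkOp N (fun _ : Fin (d + 1) => N₀))
              *ᵥ col (covOp N (fun _ : Fin (d + 1) => N₀) 1) q) X' := by
      rw [colOp_succ_sub_eq_Hk N R (fun _ : Fin (d + 1) => N₀) 1 one_pos hN hRN, ← HkOp_eq_Hk (R * N) hRN (fun _ : Fin (d + 1) => N₀) 1 one_pos,
        ← HkOp_eq_Hk N hN (fun _ : Fin (d + 1) => N₀) 1 one_pos,
        Matrix.add_apply, mul_apply_eq_mulVec_col, mul_apply_eq_mulVec_col]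
    rw [e]
    set E : ℝ := Real.exp (-(δm / 2 * torusSupNorm (fun _ : Fin (d + 1) => N₀)
      (rep (fun _ : Fin (d + 1) => N₀) (blockOf (R * N) (fun _ : Fin (d + 1) => N₀) X'.1) - rep (fun _ : Fin (d + 1) => N₀) q.1))) with hE
    have hE0 : 0 ≤ E := (Real.exp_pos _).le
    calc _ ≤ ‖(HkOp (R * N) (fun _ : Fin (d + 1) => N₀) *ᵥ col (covOp (R * N) (fun _ : Fin (d + 1) => N₀) 1 - covOp N (fun _ : Fin (d + 1) => N₀) 1) q) X'‖
            + ‖((HkOp (R * N) (fun _ : Fin (d + 1) => N₀) - stairV N R (fun _ : Fin (d + 1) => N₀) * HkOp N (fun _ : Fin (d + 1) => N₀))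
                *ᵥ col (covOp N (fun _ : Fin (d + 1) => N₀) 1) q) X'‖ := norm_add_le _ _
      _ ≤ CH * (Kd * ε) * Λ * E + (d + 1) * (KH1 d / N) * Kc * Λ * E := add_le_add hF1 hF2
      _ = (CH * Kd * ε + ((d : ℝ) + 1) * KH1 d * Kc * (1 / N)) * (Λ * E) := by ring
      _ ≤ (((CH * Kc + CH * Kd + ((d : ℝ) + 1) * KH1 d * Kc) * Λ + 1) * (ε + 1 / N)) * E := by
          have hN1 : (0 : ℝ) ≤ 1 / N := by positivity
          have hS0 : 0 ≤ CH * Kc + CH * Kd + ((d : ℝ) + 1) * KH1 d * Kc := by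
            nlinarith [mul_nonneg hCH0 hKc.le, mul_nonneg hCH0 hKd.le, mul_nonneg hCK0 hKc.le]
          have h1 : CH * Kd * ε ≤ (CH * Kc + CH * Kd + ((d : ℝ) + 1) * KH1 d * Kc) * ε := by
            apply mul_le_mul_of_nonneg_right _ hε0; nlinarith [mul_nonneg hCH0 hKc.le, mul_nonneg hCK0 hKc.le]
          have h2 : ((d : ℝ) + 1) * KH1 d * Kc * (1 / N) ≤ (CH * Kc + CH * Kd + ((d : ℝ) + 1) * KH1 d * Kc) * (1 / N) := by
            apply mul_le_mul_of_nonneg_right _ hN1; nlinarith [mul_nonneg hCH0 hKc.le, mul_nonneg hCH0 hKd.le]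
          have h3 : (CH * Kd * ε + ((d : ℝ) + 1) * KH1 d * Kc * (1 / N)) * (Λ * E)
              ≤ ((CH * Kc + CH * Kd + ((d : ℝ) + 1) * KH1 d * Kc) * (ε + 1 / N)) * (Λ * E) := by
            apply mul_le_mul_of_nonneg_right _ (mul_nonneg hΛ0 hE0); linarith
          have h4 : ((CH * Kc + CH * Kd + ((d : ℝ) + 1) * KH1 d * Kc) * (ε + 1 / N)) * (Λ * E)
              = (((CH * Kc + CH * Kd + ((d : ℝ) + 1) * KH1 d * Kc) * Λ) * (ε + 1 / N)) * E := by ring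
          have h5 : (((CH * Kc + CH * Kd + ((d : ℝ) + 1) * KH1 d * Kc) * Λ) * (ε + 1 / N)) * E
              ≤ (((CH * Kc + CH * Kd + ((d : ℝ) + 1) * KH1 d * Kc) * Λ + 1) * (ε + 1 / N)) * E := by
            apply mul_le_mul_of_nonneg_right _ hE0
            apply mul_le_mul_of_nonneg_right _ (add_nonneg hε0 hN1)
            linarith
          linarith

end Cubic

end Summit.QuantumFields.BalabanUV.Beta.GAN24.SoftColumnKernelDecay

end
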